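import Literature.Geometry.Kaehler.ComplexTorusHodgeLieAlgebraIsogeny
import Literature.Geometry.Kaehler.ComplexTorusProductPowerIsomorphisms
import Literature.Geometry.Kaehler.ComplexTorusHodgeLieAlgebraProductsPowers
import Literature.Geometry.Kaehler.ComplexTorusHodgeLieAlgebraCommutativeDimension
import HarnessLib

/-!
# Products of ISOGENOUS factors: `dim 𝔥𝔤_ℝ(X₁ × X₂) = dim 𝔥𝔤_ℝ(X)` for `X₁ ∼ X ∼ X₂`, and the abelian surfaces
# `E × E'` with `E ∼ E'`: `(dim 𝔨, dim 𝔭, dim 𝔥𝔤_ℝ) = (1, 0, 1)` (CM) or `(1, 2, 3)` (no CM)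

[cite: MoonenZarhin1999LowDim, (0.2) (4), §1 and §2 (2.1)] [cite: FiteEtAl2012, §3.2 Lemma 3.7 and §4.2 (types **E**, **F**)]
[cite: Imai1976HodgeGroups, §2 (p. 368)] [cite: Lange2023AbelianVarietiesComplex, §2.6.3 Exercise (2)]

Layer `Literature/Geometry/Kaehler`, namespace `Literature.Geometry.Kaehler.ComplexTorus`; lane `lit-hodgefound`
(Track 2 foundations library), Layer A, prover seat p17 (generation 20), self-proposed row g20-#3 of
`run/shared/lean/pub/lit-hodgefound/SKELETON.md` — the companion of row g20-#2 (`ComplexTorusHodgeLieAlgebraEllipticProducts`: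
the NON-isogenous products `E × E'` realise `(2,0,2)`, `(2,2,4)`, `(2,4,6)`), completing the list of
`(dim 𝔨, dim 𝔭, dim 𝔥𝔤_ℝ)` for ALL products of two elliptic curves: `E ∼ E'` gives `(1,0,1)` with and `(1,2,3)` without complex
multiplication (Kedlaya's "`E₁ × E₁`", "`E₂ × E₂`"; FKRS types **F** "isogenous to the square of an elliptic curve with CM" and **E**).
Sequel, BY NAME, of `ComplexTorusHodgeLieAlgebraIsogeny` (p17 g17-#5: `IsIsogenous.finrank_hodgeGroupLie_eq` — `dim 𝔥𝔤_ℝ` is an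
isogeny invariant), `ComplexTorusProductPowerIsomorphisms` (`IsIsogenous.prod_powPeriod_two`: `X₁ ∼ X`, `X₂ ∼ X ⟹ X₁ × X₂ ∼ X²`),
`ComplexTorusHodgeLieAlgebraProductsPowers` (g17-#4: `finrank_hodgeGroupLie_pow` — `dim 𝔥𝔤_ℝ(X²) = dim 𝔥𝔤_ℝ(X)`),
`ComplexTorusEllipticCurveHodgeLieAlgebra` (g17-#2: `dim 𝔥𝔤_ℝ(E_τ) ∈ {1, 3}`), `ComplexTorusHodgeLieAlgebraCartanPTrivial` (g18-#2 +
rider: `dim 𝔥𝔤_ℝ = dim 𝔨 + dim 𝔭`, `dim 𝔨 ≥ 1`, `𝔭 ≠ 0 ⟹ dim 𝔭 ≥ 2`), `ComplexTorusHodgeLieAlgebraCommutativeDimension`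
(g19-#2: `𝔭 = 0 ⟹ dim 𝔥𝔤_ℝ ≤ g`), `ComplexTorusIsogenies` (`isIsogenous_ellipticPeriod_iff_exists_int`), `ComplexTorusProduct`
(`IsAbelianVariety.prod`), `ComplexTorusEllipticCurve` (`isAbelianVariety_elliptic`).  THEOREMS ONLY: no definition, no named fact,
no instance attribute, net debt 0; imports only modules whose build is available.

## The mathematics and its sources, quoted

"For `n ≥ 1` we can identify `Hg(Xⁿ)` with `Hg(X)`, acting diagonally on `V_{Xⁿ} = (V_X)ⁿ`" [MoonenZarhin1999LowDim, §1] and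
the Hodge group is an isogeny invariant [ibid., (0.2) (4)]; so for `X₁ ∼ X ∼ X₂` one has `X₁ × X₂ ∼ X²`
[Lange2023AbelianVarietiesComplex, §2.6.3 Exercise (2)] and `dim 𝔥𝔤_ℝ(X₁ × X₂) = dim 𝔥𝔤_ℝ(X²) = dim 𝔥𝔤_ℝ(X)`.  For two isogenous
elliptic curves `E_τ₁ ∼ E_τ₂` this gives `dim 𝔥𝔤_ℝ(E_τ₁ × E_τ₂) = dim 𝔥𝔤_ℝ(E_τ₂) = 1` ("`Hg(E)` is a 1-dimensional torus if `E`
is of CM-type") or `3` ("`Hg(E) = SL₂` if `E` is not of CM-type" [Imai1976HodgeGroups, §2]); as `dim 𝔨 ≥ 1`, `dim 𝔭` is even and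
— for an abelian surface — `𝔭 = 0` forces `dim 𝔥𝔤_ℝ ≤ g = 2`, the Cartan dimensions are `(dim 𝔨, dim 𝔭) = (1, 0)` resp. `(1, 2)`:
the types `𝔲(1)`, `𝔰𝔩₂(ℝ)` of the abelian-surface list, i.e. the connected Sato–Tate groups `U(1)` ("**F** `M₂(ℂ)`, which occurs
when `A_K` is isogenous to the square of an elliptic curve with CM") and `SU(2)` (type **E**) of [FiteEtAl2012, §3.2 Lemma 3.7, §4.2],
realised in [Kedlaya, *Sato–Tate groups of genus 2 curves*, arXiv:1408.6968, Thm. 3.1] by "`E₁ × E₁`" and "`E₂ × E₂`".  Explicit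
surfaces: `E_{2i} × E_i` (`E_{2τ} ∼ E_τ` by the isogeny of degree `2`) and `E_{2θ} × E_θ`, `θ = i·2^{1/4}`.

Together with g20-#2, EVERY product of two elliptic curves has
`(dim 𝔨, dim 𝔭, dim 𝔥𝔤_ℝ) ∈ {(1,0,1), (1,2,3), (2,0,2), (2,2,4), (2,4,6)}`, the case being decided by isogeny and complex
multiplication exactly as in Imai's Proposition.

## What is proved

§1 `IsIsogenous.finrank_hodgeGroupLie_prod_eq_of_isIsogenous` (`X₁ ∼ X ∼ X₂ ⟹ dim 𝔥𝔤_ℝ(X₁ × X₂) = dim 𝔥𝔤_ℝ(X)`),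
`IsIsogenous.finrank_hodgeGroupLie_prod_eq_right`, `finrank_hodgeIsotropyLie_eq_one_of_finrank_hodgeGroupLie_eq_one`
(`dim 𝔥𝔤_ℝ = 1 ⟹ (1, 0)`), `IsAbelianVariety.finrank_hodgeIsotropyLie_eq_one_of_finrank_hodgeGroupLie_eq_three`
(`dim 𝔥𝔤_ℝ = 3 > g ⟹ (1, 2)`).  §2 **`finrank_triple_prod_ellipticPeriod_of_isIsogenous_of_ne_bot`** (`(1,0,1)`),
**`finrank_triple_prod_ellipticPeriod_of_isIsogenous_of_eq_bot`** (`(1,2,3)`), `isIsogenous_ellipticPeriod_two_mul` (`E_{2τ} ∼ E_τ`),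
`im_two_mul_ne_zero`, `ellipticEnd_two_mul_eq_bot`, `finrank_triple_prod_ellipticPeriod_two_I_I`,
`finrank_triple_prod_ellipticPeriod_two_mul_I_mul_sqrt_sqrt_two`.

NOT here: `𝔨(X₁ × X₂)`, `𝔭(X₁ × X₂)` for isogenous factors of dimension `> 1` (only `dim 𝔥𝔤_ℝ` is transported; the `g = 1`
Cartan dimensions follow by counting); products of three or more curves; anything arithmetic.

## References

* [MoonenZarhin1999LowDim] B. Moonen, Yu. G. Zarhin, *Hodge classes on abelian varieties of low dimension*, Math. Ann. 315
  (1999) 711–733, (0.2) (4), §1, §2 (2.1) (held copy `paper:arxiv-math_9901113`, p0002, p0005).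
* [FiteEtAl2012] F. Fité, K. S. Kedlaya, V. Rotger, A. V. Sutherland, *Sato–Tate distributions and Galois endomorphism modules
  in genus 2*, Compositio Math. 148 (2012), §3.2 Lemma 3.7, §4.2 (held copy `paper:arxiv-1110.6638`, p0011, p0014).
* K. S. Kedlaya, *Sato–Tate groups of genus 2 curves*, arXiv:1408.6968 (2014), Thm. 3.1 (held copy `paper:arxiv-1408.6968`, p0011).
* [Imai1976HodgeGroups] H. Imai, *On the Hodge groups of some abelian varieties*, Kodai Math. Sem. Rep. 27 (1976), §2 (p. 368).
* [Lange2023AbelianVarietiesComplex] H. Lange, *Abelian Varieties over the Complex Numbers* (2023), §2.6.3 Exercise (2).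
* [DiamondShurman2005] F. Diamond, J. Shurman, *A First Course in Modular Forms* (2005), §1.3 (p. 28).
* [SilvermanAEC2009] J. H. Silverman, *The Arithmetic of Elliptic Curves*, 2nd ed. (2009), Ch. VI Thm. 5.5.
-/

noncomputable section

open scoped Matrix Real

open Set Function Module Matrix NormedSpace Complex

namespace Literature.Geometry.Kaehler

namespace ComplexTorus

/-! ## §1 `X₁ ∼ X ∼ X₂ ⟹ dim 𝔥𝔤_ℝ(X₁ × X₂) = dim 𝔥𝔤_ℝ(X)` -/

section IsogenousProduct

variable {ι ι₁ ι₂ : Type*} [Fintype ι] [Fintype ι₁] [Fintype ι₂] [DecidableEq ι] [DecidableEq ι₁] [DecidableEq ι₂]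
  {E E₁ E₂ : Type*} [NormedAddCommGroup E] [NormedSpace ℂ E] [NormedAddCommGroup E₁] [NormedSpace ℂ E₁]
  [NormedAddCommGroup E₂] [NormedSpace ℂ E₂]
  {Φ : (ι → ℝ) ≃L[ℝ] E} {Φ₁ : (ι₁ → ℝ) ≃L[ℝ] E₁} {Φ₂ : (ι₂ → ℝ) ≃L[ℝ] E₂}

/-- **`X₁ ∼ X`, `X₂ ∼ X ⟹ dim_ℝ 𝔥𝔤_ℝ(X₁ × X₂) = dim_ℝ 𝔥𝔤_ℝ(X)`**: `X₁ × X₂ ∼ X²` (the tree's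
`IsIsogenous.prod_powPeriod_two`), `dim 𝔥𝔤_ℝ` is an isogeny invariant (g17-#5) and `𝔥𝔤_ℝ(X²) = Δ₂ 𝔥𝔤_ℝ(X)` (g17-#4).
[cite: MoonenZarhin1999LowDim, (0.2) (4) and §1 ("For `n ≥ 1` we can identify `Hg(Xⁿ)` with `Hg(X)`, acting diagonally")]
[cite: Lange2023AbelianVarietiesComplex, §2.6.3 Exercise (2) (iv) ⟹ (ii)] -/
theorem IsIsogenous.finrank_hodgeGroupLie_prod_eq_of_isIsogenous (h₁ : IsIsogenous Φ₁ Φ) (h₂ : IsIsogenous Φ₂ Φ) :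
    finrank ℝ (hodgeGroupLie (prodPeriod Φ₁ Φ₂)) = finrank ℝ (hodgeGroupLie Φ) := by
  rw [(h₁.prod_powPeriod_two h₂).finrank_hodgeGroupLie_eq, finrank_hodgeGroupLie_pow Φ two_pos]

/-- **`X₁ ∼ X₂ ⟹ dim_ℝ 𝔥𝔤_ℝ(X₁ × X₂) = dim_ℝ 𝔥𝔤_ℝ(X₂)`** (isogenous factors: the product is isogenous to the square `X₂²`).
[cite: MoonenZarhin1999LowDim, (0.2) (4) and §1] [cite: Lange2023AbelianVarietiesComplex, §2.6.3 Exercise (2)] -/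
theorem IsIsogenous.finrank_hodgeGroupLie_prod_eq_right (h : IsIsogenous Φ₁ Φ₂) :
    finrank ℝ (hodgeGroupLie (prodPeriod Φ₁ Φ₂)) = finrank ℝ (hodgeGroupLie Φ₂) :=
  h.finrank_hodgeGroupLie_prod_eq_of_isIsogenous (IsIsogenous.refl Φ₂)

/-- A torus with `dim 𝔥𝔤_ℝ = 1` (`ι ≠ ∅`) has `(dim 𝔨, dim 𝔭) = (1, 0)`: `𝔥𝔤_ℝ = ℝJ`.
[cite: MoonenZarhin1999LowDim, §2 (2.1) (Type IV(1,1))] [cite: Imai1976HodgeGroups, §2 (p. 368)] -/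
theorem finrank_hodgeIsotropyLie_eq_one_of_finrank_hodgeGroupLie_eq_one [Nonempty ι]
    (h1 : finrank ℝ (hodgeGroupLie Φ) = 1) :
    finrank ℝ (hodgeIsotropyLie Φ) = 1 ∧ finrank ℝ (hodgeCartanP Φ) = 0 := by
  have h2 := finrank_hodgeGroupLie_eq_finrank_hodgeIsotropyLie_add_finrank_hodgeCartanP Φ
  have h3 := finrank_hodgeIsotropyLie_pos Φ
  omega

/-- An abelian variety with `dim 𝔥𝔤_ℝ = 3 > g` (`ι ≠ ∅`) has `(dim 𝔨, dim 𝔭) = (1, 2)`: `𝔭 = 0` would make `𝔥𝔤_ℝ`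
commutative of dimension `≤ g` (g19-#2), and `dim 𝔭` is even. [cite: MoonenZarhin1999LowDim, §2 (2.1) (Type I(1)) and Prop. (2.4) (2)]
[cite: Imai1976HodgeGroups, §2 (p. 368)] -/
theorem IsAbelianVariety.finrank_hodgeIsotropyLie_eq_one_of_finrank_hodgeGroupLie_eq_three [FiniteDimensional ℂ E]
    [Nonempty ι] (hX : IsAbelianVariety Φ) (hg : finrank ℂ E < 3) (h3 : finrank ℝ (hodgeGroupLie Φ) = 3) :
    finrank ℝ (hodgeIsotropyLie Φ) = 1 ∧ finrank ℝ (hodgeCartanP Φ) = 2 := by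
  have h2 := finrank_hodgeGroupLie_eq_finrank_hodgeIsotropyLie_add_finrank_hodgeCartanP Φ
  have hk := finrank_hodgeIsotropyLie_pos Φ
  have hne : hodgeCartanP Φ ≠ ⊥ := fun hbot ↦ by
    have h := hX.finrank_hodgeGroupLie_le_of_hodgeCartanP_eq_bot hbot
    omega
  have hp := two_le_finrank_hodgeCartanP_of_ne_bot Φ hne
  omega

end IsogenousProduct

/-! ## §2 Two ISOGENOUS elliptic curves: `(dim 𝔨, dim 𝔭, dim 𝔥𝔤_ℝ)(E_τ₁ × E_τ₂) = (1, 0, 1)` or `(1, 2, 3)` -/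

section Elliptic

variable {τ₁ τ₂ : ℂ}

/-- **TYPE `𝔲(1)` = `(1, 0, 1)`: two ISOGENOUS CM curves** (`E_τ₁ ∼ E_τ₂`, complex multiplication): `E_τ₁ × E_τ₂ ∼ E_τ₂²`,
`𝔥𝔤_ℝ = ℝJ` ("`E₁ × E₁`": connected Sato–Tate group `U(1)`; "`M₂(ℂ)`, which occurs when `A_K` is isogenous to the square of an
elliptic curve with CM").
[cite: FiteEtAl2012, §3.2 Lemma 3.7 and §4.2 (type **F**)] [cite: MoonenZarhin1999LowDim, §1 and §2 (2.1)] [cite: Imai1976HodgeGroups, §2 (p. 368)] -/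
theorem finrank_triple_prod_ellipticPeriod_of_isIsogenous_of_ne_bot (hτ₁ : τ₁.im ≠ 0) (hτ₂ : τ₂.im ≠ 0)
    (h : IsIsogenous (ellipticPeriod hτ₁) (ellipticPeriod hτ₂)) (h₂ : ellipticEnd hτ₂ ≠ ⊥) :
    finrank ℝ (hodgeIsotropyLie (prodPeriod (ellipticPeriod hτ₁) (ellipticPeriod hτ₂))) = 1 ∧
      finrank ℝ (hodgeCartanP (prodPeriod (ellipticPeriod hτ₁) (ellipticPeriod hτ₂))) = 0 ∧
        finrank ℝ (hodgeGroupLie (prodPeriod (ellipticPeriod hτ₁) (ellipticPeriod hτ₂))) = 1 := by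
  have h1 : finrank ℝ (hodgeGroupLie (prodPeriod (ellipticPeriod hτ₁) (ellipticPeriod hτ₂))) = 1 := by
    rw [h.finrank_hodgeGroupLie_prod_eq_right, finrank_hodgeGroupLie_ellipticPeriod_of_ne_bot hτ₂ h₂]
  have h0 := finrank_hodgeIsotropyLie_eq_one_of_finrank_hodgeGroupLie_eq_one h1
  exact ⟨h0.1, h0.2, h1⟩

/-- **TYPE `𝔰𝔩₂(ℝ)` = `(1, 2, 3)`: two ISOGENOUS curves WITHOUT complex multiplication** (`Im τᵢ > 0`): `E_τ₁ × E_τ₂ ∼ E_τ₂²`,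
`𝔥𝔤_ℝ = Δ𝔰𝔩₂(ℝ)` ("`E₂ × E₂`": connected Sato–Tate group `SU(2)`).
[cite: FiteEtAl2012, §3.2 Lemma 3.7 and §4.2 (type **E**)] [cite: MoonenZarhin1999LowDim, §1 and §2 (2.1)] [cite: Imai1976HodgeGroups, §2 (p. 368)] -/
theorem finrank_triple_prod_ellipticPeriod_of_isIsogenous_of_eq_bot (hτ₁ : 0 < τ₁.im) (hτ₂ : 0 < τ₂.im)
    (h : IsIsogenous (ellipticPeriod hτ₁.ne') (ellipticPeriod hτ₂.ne')) (h₂ : ellipticEnd hτ₂.ne' = ⊥) :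
    finrank ℝ (hodgeIsotropyLie (prodPeriod (ellipticPeriod hτ₁.ne') (ellipticPeriod hτ₂.ne'))) = 1 ∧
      finrank ℝ (hodgeCartanP (prodPeriod (ellipticPeriod hτ₁.ne') (ellipticPeriod hτ₂.ne'))) = 2 ∧
        finrank ℝ (hodgeGroupLie (prodPeriod (ellipticPeriod hτ₁.ne') (ellipticPeriod hτ₂.ne'))) = 3 := by
  have h3 : finrank ℝ (hodgeGroupLie (prodPeriod (ellipticPeriod hτ₁.ne') (ellipticPeriod hτ₂.ne'))) = 3 := by
    rw [h.finrank_hodgeGroupLie_prod_eq_right, finrank_hodgeGroupLie_ellipticPeriod_of_eq_bot hτ₂.ne' h₂]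
  have hX : IsAbelianVariety (prodPeriod (ellipticPeriod hτ₁.ne') (ellipticPeriod hτ₂.ne')) :=
    (isAbelianVariety_elliptic hτ₁).prod (isAbelianVariety_elliptic hτ₂)
  have hg : finrank ℂ (ℂ × ℂ) < 3 := by
    rw [Module.finrank_prod, Module.finrank_self]
    norm_num
  have h0 := hX.finrank_hodgeIsotropyLie_eq_one_of_finrank_hodgeGroupLie_eq_three hg h3
  exact ⟨h0.1, h0.2, h3⟩

/-- **`E_{2τ} ∼ E_τ`** (the isogeny `z ↦ z` of degree `2`: `(0·τ + 2)·(2τ)⁻¹`… explicitly `2 · τ = 1 · (2τ) + 0`).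
[cite: DiamondShurman2005, §1.3 p. 28 (`E_τ ∼ E_{τ'}` iff `τ = α(τ')`, `α` integral, `det α ≠ 0`)] -/
theorem isIsogenous_ellipticPeriod_two_mul (hτ : τ₁.im ≠ 0) (h2 : (2 * τ₁).im ≠ 0) :
    IsIsogenous (ellipticPeriod h2) (ellipticPeriod hτ) := by
  rw [isIsogenous_ellipticPeriod_iff_exists_int]
  exact ⟨2, 0, 0, 1, by norm_num, by push_cast; ring⟩

/-- `Im(2τ) ≠ 0`. [cite: DiamondShurman2005, §1.3 p. 28] -/
theorem im_two_mul_ne_zero (hτ : τ₁.im ≠ 0) : (2 * τ₁).im ≠ 0 := by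
  rw [show (2 : ℂ) * τ₁ = (2 : ℝ) • τ₁ by rw [Complex.real_smul]; norm_num, Complex.smul_im, smul_eq_mul]
  exact mul_ne_zero two_ne_zero hτ

/-- `E_{2τ}` has complex multiplication iff `E_τ` has: a relation `(2τ)² + p(2τ) + q = 0` is `τ² + (p/2)τ + q/4 = 0`.
[cite: SilvermanAEC2009, Ch. VI Thm. 5.5] -/
theorem ellipticEnd_two_mul_eq_bot (hτ : τ₁.im ≠ 0) (h : ellipticEnd hτ = ⊥) :
    ellipticEnd (im_two_mul_ne_zero hτ) = ⊥ := by
  rw [ellipticEnd_eq_bot_iff] at h ⊢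
  intro p q hpq
  refine h (p / 2) (q / 4) ?_
  have h' : (2 * τ₁) ^ 2 + (p : ℂ) * (2 * τ₁) + (q : ℂ) = 4 * (τ₁ ^ 2 + ((p / 2 : ℚ) : ℂ) * τ₁ + ((q / 4 : ℚ) : ℂ)) := by
    push_cast
    ring
  rw [h'] at hpq
  exact (mul_eq_zero.1 hpq).resolve_left (by norm_num)

/-- **`E_{2i} × E_i`: type `(1, 0, 1)`** (isogenous CM curves). [cite: FiteEtAl2012, §4.2 (type **F**)] [cite: MoonenZarhin1999LowDim, §1] -/
theorem finrank_triple_prod_ellipticPeriod_two_I_I :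
    finrank ℝ (hodgeIsotropyLie (prodPeriod (ellipticPeriod (im_two_mul_ne_zero (τ₁ := I) (by simp)))
      (ellipticPeriod (τ := I) (by simp)))) = 1 ∧
    finrank ℝ (hodgeCartanP (prodPeriod (ellipticPeriod (im_two_mul_ne_zero (τ₁ := I) (by simp)))
      (ellipticPeriod (τ := I) (by simp)))) = 0 ∧
    finrank ℝ (hodgeGroupLie (prodPeriod (ellipticPeriod (im_two_mul_ne_zero (τ₁ := I) (by simp)))
      (ellipticPeriod (τ := I) (by simp)))) = 1 :=
  finrank_triple_prod_ellipticPeriod_of_isIsogenous_of_ne_bot _ _ (isIsogenous_ellipticPeriod_two_mul _ _)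
    ((ellipticEnd_ne_bot_iff _).2 ⟨0, 1, by simp [sq, I_mul_I]⟩)

/-- **`E_{2θ} × E_θ`, `θ = i·2^{1/4}`: type `(1, 2, 3)`** (isogenous curves without CM).
[cite: FiteEtAl2012, §4.2 (type **E**)] [cite: MoonenZarhin1999LowDim, §1] -/
theorem finrank_triple_prod_ellipticPeriod_two_mul_I_mul_sqrt_sqrt_two :
    finrank ℝ (hodgeIsotropyLie (prodPeriod (ellipticPeriod (im_two_mul_ne_zero im_I_mul_sqrt_sqrt_two_ne_zero))
      (ellipticPeriod im_I_mul_sqrt_sqrt_two_ne_zero))) = 1 ∧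
    finrank ℝ (hodgeCartanP (prodPeriod (ellipticPeriod (im_two_mul_ne_zero im_I_mul_sqrt_sqrt_two_ne_zero))
      (ellipticPeriod im_I_mul_sqrt_sqrt_two_ne_zero))) = 2 ∧
    finrank ℝ (hodgeGroupLie (prodPeriod (ellipticPeriod (im_two_mul_ne_zero im_I_mul_sqrt_sqrt_two_ne_zero))
      (ellipticPeriod im_I_mul_sqrt_sqrt_two_ne_zero))) = 3 := by
  have hθ : 0 < (I * (Real.sqrt (Real.sqrt 2) : ℂ)).im := by
    rw [I_mul_im, ofReal_re]
    positivity
  have h2θ : 0 < (2 * (I * (Real.sqrt (Real.sqrt 2) : ℂ))).im := by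
    have h := im_two_mul_ne_zero im_I_mul_sqrt_sqrt_two_ne_zero
    rw [show (2 : ℂ) * (I * (Real.sqrt (Real.sqrt 2) : ℂ)) = (2 : ℝ) • (I * (Real.sqrt (Real.sqrt 2) : ℂ)) by
      rw [Complex.real_smul]; norm_num, Complex.smul_im, smul_eq_mul]
    positivity
  exact finrank_triple_prod_ellipticPeriod_of_isIsogenous_of_eq_bot h2θ hθ (isIsogenous_ellipticPeriod_two_mul _ _)
    ellipticEnd_I_mul_sqrt_sqrt_two_eq_bot

end Elliptic

end ComplexTorus

end Literature.Geometry.Kaehler
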